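import Mathlib
import Literature.Analysis.FluidPDE.ClassicalSolution
import Literature.Analysis.FluidPDE.VorticityCalculus
import Summits.NavierStokesRegularity.NavierStokesRegularity.Theorems.ThreadingFluxHorizonTowerDefs
import Summits.NavierStokesRegularity.NavierStokesRegularity.Theorems.ThreadingFluxHorizonTowerSecondJetHeadForm
import Summits.NavierStokesRegularity.NavierStokesRegularity.Theorems.ThreadingFluxHorizonOrderOneLawBlowdown
import Summits.NavierStokesRegularity.NavierStokesRegularity.Theorems.ThreadingFluxHorizonBlowdownJetCalculus
import Summits.NavierStokesRegularity.NavierStokesRegularity.Theorems.ThreadingFluxHorizonBlowdownRescaledLimit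
import Summits.NavierStokesRegularity.NavierStokesRegularity.Theorems.ThreadingFluxHorizonOrderTwoLawBlowdownTools
import HarnessLib

/-!
# Crux `PoloidalLiouville` (stmt-NavierStokesRegularity-1222, W1), crux idea «horizon-threading-tower» (ns-idea-15):
# THE ORDER-TWO HORIZON LAW, BLOW-DOWN FORM — `𝔏₁[U] ≡ 0 ∧ 𝔏₂[U] ≡ 0` for homogeneous `C⁶` blow-down limits
# (layer (D): the sketch's `OrderTwoHorizonLawBlowdown`, Defs l.189, WITH the regularity of the limit made explicit)

If a classical Navier–Stokes solution (`ν = 1`, no force) on an open time window `S ∋ t₀` is UNTHREADED about `x₀`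
(`F(t,x) = ⟪curl u(t) x, x − x₀⟫ ≡ 0` on `S`), and the slice `(u t₀, p t₀)` has a blow-down limit `(U, P₀ + s₀ log r)` about `x₀`
in the `C⁶ × C²` jet sense of `IsBlowdownLimit`, with `U` degree-0 homogeneous and `C⁶` off the origin and `P₀` dilation
invariant and `C²` off the origin, then BOTH horizon laws annihilate the profile: `horizonL1 U 0 ≡ 0` (order one, landed in
`ThreadingFluxHorizonOrderOneLawBlowdown`) and `horizonL2 U 0 ≡ 0` (order two, this file).

Proof (order two).  `∂ₜ²F(t₀,·) = 0` on the window and `HorizonTower.secondJetHeadForm` give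
`Loc₂[w](x) = ⟪curl w, ∇(radialVirial (head w q) x₀)⟫(x)` for the slice `w = u t₀`, `q = p t₀` at EVERY `x`
(`OrderTwoBlowdown.loc2_eq_headTerm_of_unthreaded`), so the rescaled balance
`λₖ² (Loc₂[w] − ⟪curl w, ∇(radialVirial (head w q) x₀)⟫)(x₀ + λₖ z)` is identically zero.  By the analytic core
`OrderTwoBlowdown.tendsto_rescaled_loc2_sub_head` (`ThreadingFluxHorizonBlowdownRescaledLimit`: layers (A) `JetConv`, (B), (C)
`Scaling.loc2_affine` / `Scaling.headTerm_affine`), applied to the blow-down sequence of `IsBlowdownLimit` read pointwise at `z`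
after replacing `U`, `P₀ + s₀ log r` by global `C⁶`/`C²` cut-off representatives `V`, `Q` near `z`, the same sequence tends to
`⟪z, 𝔏₂-bracket of V⟫(z) − ⟪curl V z, ∇(radialVirial (head V Q) 0) z⟫`; the head part is `0` because that radial virial is the
constant `s₀` near `z` (`OrderTwoBlowdown.radialVirial_head_eventuallyEq_const`: the pressure drops out at the horizon).  Hence the
bracket vanishes, i.e. `horizonL2 V 0 z = 0 = horizonL2 U 0 z` (germ-locality).

The last two declarations restate the result with the binder structure of the custodian's sketch Props
`OrderTwoHorizonLawBlowdownReg` / `HorizonSieveReg` (`Cruxes/PoloidalLiouville/HorizonTowerSketch.lean` v3, l.329 / l.339,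
bodies verbatim over the definitional-twin vocabulary of `ThreadingFluxHorizonTowerDefs`), so that both close BY NAME.
BOOKING: LEVER rung of the horizon card (information-grade, below W1); ⟨1222⟩ stays OPEN; NS regularity is NOT proved.
-/

-- the summit and its single problem share the name (D-0017 nested layout)
set_option linter.dupNamespace false

noncomputable section

namespace Summit.NavierStokesRegularity.NavierStokesRegularity.Theorems.PoloidalLiouville.HorizonTower

open Set Function Filter Topology Metric
open scoped Topology RealInnerProductSpace Laplacian ContDiff
open Literature.Analysis.FluidPDE

/-- **THE ORDER-TWO HORIZON LAW, BLOW-DOWN FORM** (the sketch's `OrderTwoHorizonLawBlowdown`, `ThreadingFluxHorizonTowerDefs`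
l.189, with the regularity of the limit made explicit: `U ∈ C⁶`, `P₀ ∈ C²` off the origin).  If a classical Navier–Stokes
solution (`ν = 1`, no force) on an open set of times `S ∋ t₀` is unthreaded about `x₀` on `S`, and the slice `u t₀` with its
pressure has a blow-down limit `(U, P₀ + s₀ log r)` about `x₀` with `U`, `P₀` degree-0 homogeneous, then BOTH horizon laws
annihilate the profile: `horizonL1 U 0 y = 0` and `horizonL2 U 0 y = 0` for every `y ≠ 0`. -/
theorem orderTwoHorizonLawBlowdown_of_contDiffOn (S : Set ℝ) (u : ℝ → E3 → E3) (p : ℝ → E3 → ℝ) (x₀ : E3) (t₀ : ℝ)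
    (U : E3 → E3) (P₀ : E3 → ℝ) (s₀ : ℝ) (hS : IsOpen S) (ht₀ : t₀ ∈ S) (hNS : IsClassicalNSSolutionOn S 1 0 u p)
    (hF : ∀ t ∈ S, ∀ x, threadingFlux u x₀ t x = 0)
    (hUhom : IsZeroHomogeneousAbout 0 U) (hPhom : ∀ c : ℝ, 0 < c → ∀ y : E3, P₀ (c • y) = P₀ y)
    (hU : ContDiffOn ℝ 6 U {0}ᶜ) (hP : ContDiffOn ℝ 2 P₀ {0}ᶜ)
    (hbd : IsBlowdownLimit (u t₀) (p t₀) x₀ U (fun y : E3 => P₀ y + s₀ * Real.log ‖y‖)) :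
    ∀ y : E3, y ≠ 0 → horizonL1 U 0 y = 0 ∧ horizonL2 U 0 y = 0 := by
  intro z hz
  refine ⟨orderOneHorizonLawBlowdown S u p x₀ t₀ U _ hS ht₀ hNS hF (hU.of_le (by norm_cast)) hbd z hz, ?_⟩
  /- the slice, its pressure, smoothness -/
  set w : E3 → E3 := u t₀ with hw
  set q : E3 → ℝ := p t₀ with hq
  have hinS : ∀ x : E3, (t₀, x) ∈ S ×ˢ (univ : Set E3) := fun x => ⟨ht₀, mem_univ _⟩
  have hws : ContDiff ℝ (⊤ : ℕ∞) w := hNS.smooth_velocity.comp_contDiff (contDiff_const.prodMk contDiff_id) hinS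
  have hqs : ContDiff ℝ (⊤ : ℕ∞) q := hNS.smooth_pressure.comp_contDiff (contDiff_const.prodMk contDiff_id) hinS
  /- Step 0: `∂ₜ²F(t₀, x) = 0`, hence `Loc₂[w](x) = ⟪curl w x, ∇(radialVirial (head w q) x₀)(x)⟫` for every `x` -/
  have hjet : ∀ x : E3, loc2 w x₀ x = inner ℝ (curl w x) (gradient (radialVirial (head w q) x₀) x) := fun x =>
    OrderTwoBlowdown.loc2_eq_headTerm_of_unthreaded hS ht₀ hNS hF x
  /- cut-offs: global `C⁶` / `C²` representatives of the limit profile and the limit pressure near `z` -/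
  set Pinf : E3 → ℝ := fun y => P₀ y + s₀ * Real.log ‖y‖ with hPinf
  have hPinfC : ContDiffOn ℝ 2 Pinf {0}ᶜ := by
    refine hP.add (contDiffOn_const.mul ?_)
    intro y hy
    have hy' : (y : E3) ≠ 0 := hy
    exact ((contDiffAt_norm ℝ hy').log (norm_ne_zero_iff.mpr hy')).contDiffWithinAt
  obtain ⟨V, hVC, hVU⟩ := OrderTwoBlowdown.exists_contDiff_eventuallyEq hU hz
  obtain ⟨Q, hQC, hQP⟩ := OrderTwoBlowdown.exists_contDiff_eventuallyEq hPinfC hz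
  /- the blow-down data at `z`, in the jet-convergence shape, for the cut-off representatives -/
  obtain ⟨lam, c, hlam, hjV, hjP⟩ := JetConv.of_isBlowdownLimit hbd
  have hV6 : ∀ j ≤ 6, Tendsto (fun k => ‖iteratedFDeriv ℝ j (fun y => w (x₀ + lam k • y) - V y) z‖) atTop (𝓝 0) := by
    intro j hj
    refine (hjV z hz j hj).congr fun k => ?_
    have hev : (fun y : E3 => w (x₀ + lam k • y) - U y) =ᶠ[𝓝 z] fun y => w (x₀ + lam k • y) - V y := by
      filter_upwards [hVU] with y hy; rw [hy]
    rw [(hev.iteratedFDeriv ℝ j).eq_of_nhds]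
  have hQ2 : ∀ j ≤ 2, Tendsto (fun k => ‖iteratedFDeriv ℝ j (fun y => (q (x₀ + lam k • y) - c k) - Q y) z‖) atTop (𝓝 0) := by
    intro j hj
    refine (hjP z hz j hj).congr fun k => ?_
    have hev : (fun y : E3 => q (x₀ + lam k • y) - c k - Pinf y) =ᶠ[𝓝 z] fun y => (q (x₀ + lam k • y) - c k) - Q y := by
      filter_upwards [hQP] with y hy; rw [hy]
    rw [(hev.iteratedFDeriv ℝ j).eq_of_nhds]
  have hcore := OrderTwoBlowdown.tendsto_rescaled_loc2_sub_head hws hqs x₀ z hlam c hVC hQC hV6 hQ2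
  /- on the unthreaded window the rescaled sequence is IDENTICALLY ZERO (Step 0), so its limit vanishes -/
  have hzero : ∀ k, (lam k) ^ 2 * (loc2 w x₀ (x₀ + lam k • z)
      - inner ℝ (curl w (x₀ + lam k • z)) (gradient (radialVirial (head w q) x₀) (x₀ + lam k • z))) = 0 := fun k => by
    rw [hjet, sub_self, mul_zero]
  have hlimeq := tendsto_nhds_unique (tendsto_const_nhds.congr fun k => (hzero k).symm) hcore
  /- the head term vanishes in the limit: `radialVirial (head V Q) 0 ≡ s₀` near `z` (pressure drop-out) -/
  have hRconstV : radialVirial (head V Q) 0 =ᶠ[𝓝 z] fun _ => s₀ :=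
    OrderTwoBlowdown.radialVirial_head_eventuallyEq_const hz hUhom hPhom (hU.differentiableOn (by norm_num))
      (hP.differentiableOn (by norm_num)) hVU hQP
  have hgrad0 : gradient (radialVirial (head V Q) 0) z = 0 := by
    rw [gradient, hRconstV.fderiv_eq, fderiv_fun_const, Pi.zero_apply, map_zero]
  rw [hgrad0, inner_zero_right, sub_zero] at hlimeq
  /- conclude `𝔏₂[V](z) = 0`, hence `𝔏₂[U](z) = 0` -/
  have hL2V : horizonL2 V 0 z = 0 := by
    unfold horizonL2
    rw [sub_zero, ← hlimeq, mul_zero]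
  rw [← OrderTwoBlowdown.horizonL2_congr hVU]
  exact hL2V

/-- `OrderTwoHorizonLawBlowdownReg` of the sketch (`HorizonTowerSketch.lean` v3 l.329), BODY VERBATIM: the order-one/two horizon
laws in blow-down form with the limit regularity `U ∈ C⁶(ℝ³∖0)`, `P₀ ∈ C²(ℝ³∖0)` as explicit binders. -/
theorem orderTwoHorizonLawBlowdownReg :
    ∀ (S : Set ℝ) (u : ℝ → E3 → E3) (p : ℝ → E3 → ℝ) (x₀ : E3) (t₀ : ℝ) (U : E3 → E3) (P₀ : E3 → ℝ) (s₀ : ℝ),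
    IsOpen S → t₀ ∈ S → Literature.Analysis.FluidPDE.IsClassicalNSSolutionOn S 1 0 u p →
    (∀ t ∈ S, ∀ x, threadingFlux u x₀ t x = 0) →
    IsZeroHomogeneousAbout 0 U → (∀ c : ℝ, 0 < c → ∀ y : E3, P₀ (c • y) = P₀ y) →
    ContDiffOn ℝ 6 U ({0}ᶜ : Set E3) → ContDiffOn ℝ 2 P₀ ({0}ᶜ : Set E3) →
    IsBlowdownLimit (u t₀) (p t₀) x₀ U (fun y : E3 => P₀ y + s₀ * Real.log ‖y‖) →
    ∀ y : E3, y ≠ 0 → horizonL1 U 0 y = 0 ∧ horizonL2 U 0 y = 0 :=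
  fun S u p x₀ t₀ U P₀ s₀ hS ht₀ hNS hF hUhom hPhom hU hP hbd =>
    orderTwoHorizonLawBlowdown_of_contDiffOn S u p x₀ t₀ U P₀ s₀ hS ht₀ hNS hF hUhom hPhom hU hP hbd

/-- `HorizonSieveReg` of the sketch (`HorizonTowerSketch.lean` v3 l.339), BODY VERBATIM: under the hypotheses of
`PoloidalLiouville` (bounded ancient mild solution, classical on `(−∞,0)` with pressure `p`, vorticity tangent to the spheres
about `x₀`), EVERY degree-0 homogeneous blow-down limit `(U, P₀ + s₀ log r)` of every slice that is `C⁶ × C²` off the origin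
is annihilated by both horizon laws.  (Window `S = (−∞,0)`; the boundedness hypothesis is not used.) -/
theorem horizonSieveReg :
    ∀ (v : ℝ → E3 → E3) (p : ℝ → E3 → ℝ) (x₀ : E3),
    Literature.Analysis.FluidPDE.IsBoundedAncientMildSolution 1 v →
    Literature.Analysis.FluidPDE.IsClassicalNSSolutionOn (Set.Iio 0) 1 0 v p →
    (∀ t < 0, ∀ x, inner ℝ (x - x₀) (curl (v t) x) = 0) →
    ∀ t₀ < 0, ∀ (U : E3 → E3) (P₀ : E3 → ℝ) (s₀ : ℝ),
      IsZeroHomogeneousAbout 0 U → (∀ c : ℝ, 0 < c → ∀ y : E3, P₀ (c • y) = P₀ y) →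
      ContDiffOn ℝ 6 U ({0}ᶜ : Set E3) → ContDiffOn ℝ 2 P₀ ({0}ᶜ : Set E3) →
      IsBlowdownLimit (v t₀) (p t₀) x₀ U (fun y : E3 => P₀ y + s₀ * Real.log ‖y‖) →
      ∀ y : E3, y ≠ 0 → horizonL1 U 0 y = 0 ∧ horizonL2 U 0 y = 0 := by
  intro v p x₀ _hbdd hcl hunthr t₀ ht₀ U P₀ s₀ hU hP₀ hUr hPr hblow y hy
  refine orderTwoHorizonLawBlowdownReg (Set.Iio 0) v p x₀ t₀ U P₀ s₀ isOpen_Iio ht₀ hcl ?_ hU hP₀ hUr hPr hblow y hy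
  intro t ht x
  unfold threadingFlux
  rw [real_inner_comm]
  exact hunthr t ht x

end Summit.NavierStokesRegularity.NavierStokesRegularity.Theorems.PoloidalLiouville.HorizonTower

end
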